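import Summits.BirchSwinnertonDyer.Rank1Residual.X11b.KolyvaginBottomPoint
import Summits.BirchSwinnertonDyer.Rank1Residual.X11b.Three.KolyvaginLine
import Summits.BirchSwinnertonDyer.Rank1Residual.X11b.BDPRouteRankOneBookkeeping
import Literature.NumberTheory.EllipticCurves.HeegnerPointsOfConductorOneData
import Literature.NumberTheory.EllipticCurves.HeegnerPointsOfConductorOneRationalityProofs
import Literature.NumberTheory.EllipticCurves.HeegnerPointsOfConductorOneGaloisConjProofs
import Literature.NumberTheory.EllipticCurves.HeegnerPointsKolyvaginPrimaryGeneratorProofs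
import Literature.NumberTheory.EllipticCurves.BSDSelmerCMPConverseHeegnerFieldProofs
import Literature.NumberTheory.EllipticCurves.CuspFormLFunctionLevelConductorProofs
import HarnessLib

/-!
# Route `KatoDescentPotSupersingular` (rung K9, sub-rung B5 O6 wild 3, cell `bsd-potss`): the registered BC3 skeleton of
# the `q = p` crux `WildJetchevBoundAtP` (item 19941; `Cruxes/WildJetchevBoundAtP/Lines/birth.lean`, sha fa288a46e054)
# RE-KEYED on the shared structure stub S1 of crux 20165 and ONE conductor-level at-`p` divisibility statement S2p
# (seat `bsd-potss-k9-c4` g8; ROUTE-FREE sequel of `…WildJetchevBoundAtPOfStubs` — no Theses import; `--supports 19941`, helper; nothing booked,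
# no item closed, BSD is not proved by any of this)

WHAT IS PROVED. The skeleton's two registered stubs, each MINUS ITS GAUSSIAN-FIELD INSTANCES (`d_K ≠ −4` added — the
only instances the route's consumer of 19941, the J08 road at a Bump–Friedberg–Hoffstein field with `d_K < −4`, never
uses), follow from smaller displayed statements:

* S1′ `stub_structure_depth_indexForm_d3` (structure half at depth `t`, irreducible image, INDEX currency, any stated
  level `N`, every frame) ⟸ S1 = `stub_structureIrred` of crux 20165 VERBATIM (conductor level, McCallum currency; =
  `MatarNekovar2019.thm07_padicValNat_card_sha_primary_add_le_of_globalDivisibility_of_irreducible` by name) +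
  Kolyvagin 1990 + modularity (Carayol) — so 19941 needs NO second structure stub;
* S2′ `stub_derivedPoint_divisible_at_additive_p` (global divisibility to depth `ord_p c_p` on every frame of level
  `N`) ⟸ S2p (the same at conductor level, on frames whose conductor-`1` derived point has infinite order — the
  binder shape of 20165's S2) + Gross–Zagier + modularity.

Tree theorems used: Carayol from `exists_isNewformOf`; Darmon 3.6 (`phi_heegnerTau_mem_singularModuliField_holds`,
conductor-`1` datum on any frame); Shimura reciprocity (`heegnerPointOfConductor_one_galoisConj_holds`: its bottom
point is a Heegner point of `E(K)`); Mordell–Weil; McCallum Lemma 5.1 (`Three.Koly.padicValNat_index_zmultiples_eq_of_divisibility`,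
no `p`-torsion in `E(K)` for `E[p]` irreducible over an imaginary quadratic field); Gross–Zagier
(`lDerivEK_ne_zero_iff_not_isOfFinAddOrder`: all Heegner points of level `N` are non-torsion together).
CONDITIONAL on the displayed `hS` / `hDp` and the named published inputs; S2p is NOT in print (the research content
of 19941: Jetchev's Conj. 1.3 share at the additive prime, content only at `p = 3`, Kodaira IV/IV*, `c₃ = 3`);
nothing asserted; the crux and BSD stay open.

References: [Jetchev2008] Conj. 1.3, Cor. 1.5 (p. 812); [MatarNekovar2019] Thm. 0.7, §0.11 (pp. 456–457);
[McCallumLMS1991] §5 Lemma 5.1 (p. 303), Cor. 5.6 (p. 310); [GrossZagier1986] Thm. I.6.3; [GrossLMS1991] §4 (4.1);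
[Darmon2004] Thm. 3.6–3.7; [Kolyvagin1990] Thm. A.
-/

set_option autoImplicit false
-- the Theorems directory repeats the summit name (sibling precedent `KatoDescentPotSupersingularAssembly.lean`)
set_option linter.dupNamespace false

noncomputable section

open scoped Classical

namespace Summit.BirchSwinnertonDyer.BirchSwinnertonDyer.Theorems.WildJetchevBoundAtPSkeletonRekey

open WeierstrassCurve Literature.NumberTheory.EllipticCurves
  Literature.NumberTheory.EllipticCurves.ModularForms
  Literature.NumberTheory.EllipticCurves.Rank1Residual
  Summit.BirchSwinnertonDyer.Rank1Residual Summit.BirchSwinnertonDyer.Rank1Residual.X11b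

/-! ### §1 S1′ from S1 -/

/-- **S1′ of the 19941 skeleton (`stub_structure_depth_indexForm_d3`: structure half at depth `t`, irreducible image,
INDEX currency, any stated level `N`) AT `d_K ≠ −4`, from S1 + Kolyvagin + modularity** — so S1′ minus its Gaussian
instances is the shared registered stub `stub_structureIrred` of crux 20165 (one published input, MN19 Thm. 0.7 /
§0.11, by name), not a second XL stub. The global-divisibility hypothesis is the skeleton's `GlobalDivisibilityToDepth
N W K p t` unfolded (every frame of level `N`). Steps (Carayol; Darmon 3.6; Shimura; Mordell–Weil; McCallum
Lemma 5.1; as `WildJetchevBoundAtPOfStubs` §2 at general depth `t`). CONDITIONAL on `hS`, `hKo`, `hnf`; nothing asserted.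
[cite: MatarNekovar2019, Thm. 0.7 and §0.11 (pp. 456–457)] [cite: McCallumLMS1991, §5 Lemma 5.1, Cor. 5.6]
[cite: GrossLMS1991, §4 (4.1)] [cite: Darmon2004, Thm. 3.6–3.7] -/
theorem structure_depth_indexForm_of_structureIrred_of_kolyvagin_of_newforms
    (hS : ∀ (W : WeierstrassCurve ℚ) [W.IsElliptic] [W.IsGloballyMinimal] [NeZero (W.conductorNorm ℤ)],
      ¬ W.HasCM →
      ∀ (K : Type) [Field K] [NumberField K], IsImaginaryQuadratic K →
      NumberField.discr K ≠ -3 → NumberField.discr K ≠ -4 →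
      SatisfiesHeegnerHypothesis (W.conductorNorm ℤ) K →
      ∀ (p : ℕ) [Fact p.Prime], p ≠ 2 → W.HasIrreducibleModPGaloisRep p →
      ∀ (Dt : ModularParametrizationData W (W.conductorNorm ℤ)) (β : ℤ) (ι : K →+* ℂ)
        (d₁ : KolyvaginHeegnerData Dt β ι 1) (P : (W.baseChange K).toAffine.Point),
        d₁.toGeomPoints d₁.derivedPoint = toGeomPoints (W.baseChange K) P →
        ¬ IsOfFinAddOrder P →
      ∀ (M₀ : ℕ),
        (∃ Q : (W.baseChange K).toAffine.Point, ((p ^ M₀ : ℕ) : ℤ) • Q = P) →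
        (¬ ∃ Q : (W.baseChange K).toAffine.Point, ((p ^ (M₀ + 1) : ℕ) : ℤ) • Q = P) →
      ∀ (t : ℕ),
        (∀ (s : ℕ), s ≤ t → ∀ (n : ℕ) (d : KolyvaginHeegnerData Dt β ι n), Squarefree n →
          (∀ ℓ ∈ n.primeFactors, Zhang2014.IsKolyvaginPrime (W.conductorNorm ℤ) W K p ℓ ∧
            s ≤ Zhang2014.kolyvaginIndex W p ℓ) →
          ∃ Q : (W.baseChange (ringClassField K ι n)).toAffine.Point,
            ((p ^ s : ℕ) : ℤ) • Q = d.derivedPoint) →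
      padicValNat p (Nat.card (AddCommGroup.primaryComponent (W.baseChange K).sha p)) + 2 * t ≤ 2 * M₀)
    (hKo : ∀ (N : ℕ) [NeZero N] (W : WeierstrassCurve ℚ) (K : Type) [Field K] [NumberField K],
      kolyvagin N W K)
    (hnf : exists_isNewformOf)
    (N : ℕ) [NeZero N] (W : WeierstrassCurve ℚ) [W.IsElliptic] [W.IsGloballyMinimal]
    (K : Type) [Field K] [NumberField K] (hK : IsImaginaryQuadratic K)
    (hD3 : NumberField.discr K ≠ -3) (hD4 : NumberField.discr K ≠ -4)
    (hHN : SatisfiesHeegnerHypothesis N K)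
    (p : ℕ) [Fact p.Prime] (hp2 : p ≠ 2) (hcm : ¬ W.HasCM) (hirr : W.HasIrreducibleModPGaloisRep p)
    {P : (W.baseChange K).toAffine.Point} (hP : IsHeegnerPoint N W K P) (hnt : ¬ IsOfFinAddOrder P)
    (t : ℕ)
    (hdivN : ∀ (Dt : ModularParametrizationData W N) (β : ℤ) (ι : K →+* ℂ) (s : ℕ), s ≤ t →
      ∀ (n : ℕ) (d : KolyvaginHeegnerData Dt β ι n), Squarefree n →
        (∀ ℓ ∈ n.primeFactors, Zhang2014.IsKolyvaginPrime N W K p ℓ ∧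
          s ≤ Zhang2014.kolyvaginIndex W p ℓ) →
        ∃ Q : (W.baseChange (ringClassField K ι n)).toAffine.Point,
          ((p ^ s : ℕ) : ℤ) • Q = d.derivedPoint) :
    padicValNat p (Nat.card (AddCommGroup.primaryComponent (W.baseChange K).sha p)) + 2 * t ≤
      2 * padicValNat p (AddSubgroup.zmultiples P).index := by
  have hp : p.Prime := Fact.out
  obtain ⟨Dt, H, ι, hPc⟩ := id hP
  have hN : N = W.conductorNorm ℤ := IsNewformOf.level_eq_conductorNorm_of_exists_isNewformOf hnf Dt.isNewformOf
  subst hN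
  obtain ⟨hrank, -⟩ := hKo _ W K hK hHN hP hnt
  obtain ⟨d₁⟩ := exists_kolyvaginHeegnerData_one (phi_heegnerTau_mem_singularModuliField_holds _ W K) hK Dt
    H.β ι H.dvd_sq_sub
  have hPd : d₁.toGeomPoints d₁.derivedPoint = toGeomPoints (W.baseChange K) P :=
    KolyvaginBottom.toGeomPoints_derivedPoint_one_eq (heegnerPointOfConductor_one_galoisConj_holds _ W K) hK
      hHN hPc d₁ rfl
  haveI : Module.Finite ℤ (W.baseChange K).toAffine.Point := (W.baseChange K).module_finite_point_holds
  obtain ⟨M₀, x₀, hx₀, hmax⟩ := exists_pow_smul_eq_and_forall_ne hnt (p := p) hp.two_le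
  have hdiv : ∃ Q : (W.baseChange K).toAffine.Point, ((p ^ M₀ : ℕ) : ℤ) • Q = P :=
    ⟨x₀, by rw [natCast_zsmul]; exact hx₀⟩
  have hndiv : ¬ ∃ Q : (W.baseChange K).toAffine.Point, ((p ^ (M₀ + 1) : ℕ) : ℤ) • Q = P := by
    rintro ⟨Q, hQ⟩
    exact hmax Q (by rw [← natCast_zsmul]; exact hQ)
  -- S1 on the frame of `P`, the divisibility to depth `t` supplied on that frame by `hdivN`
  have hle := hS W hcm K hK hD3 hD4 hHN p hp2 hirr Dt H.β ι d₁ P hPd hnt M₀ hdiv hndiv t (hdivN Dt H.β ι)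
  have hbot := torsionBy_eq_bot_of_isImaginaryQuadratic_of_hasIrreducibleModPGaloisRep W K hK hp hirr
  have hiv : ∀ x : (W.baseChange K).toAffine.Point, p • x = 0 → x = 0 := fun x hx ↦ by
    have hmem : x ∈ AddSubgroup.torsionBy (W.baseChange K).toAffine.Point ((p : ℕ) : ℤ) := by
      rw [mem_torsionBy_iff, natCast_zsmul]
      exact hx
    rw [hbot] at hmem
    exact hmem
  haveI : Finite (AddCommGroup.torsion (W.baseChange K).toAffine.Point) :=
    WeierstrassCurve.finite_torsion_point (W := W.baseChange K)
  obtain ⟨c, Q, hcQ, hcker⟩ := RankOne.exists_coord_of_mordellWeilRank_eq_one (W.baseChange K) hrank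
  have hidx : padicValNat p (AddSubgroup.zmultiples P).index = M₀ :=
    Three.Koly.padicValNat_index_zmultiples_eq_of_divisibility c Q hcQ hcker hiv P hdiv hndiv
  rw [hidx]
  exact hle

/-! ### §2 S2′ from S2p -/

/-- **S2′ of the 19941 skeleton (`stub_derivedPoint_divisible_at_additive_p`: global divisibility to depth
`ord_p c_p` on EVERY frame of the stated level `N`) AT `d_K ≠ −4`, from the conductor-level S2p + Gross–Zagier +
modularity.** Carayol (`N = N_E`); on the given frame `(Dt, β, ι)` a conductor-`1` datum `d₁` exists (Darmon 3.6,
the orientation congruence read off the given datum `d`); its derived point descends to a Heegner point `P₀ ∈ E(K)`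
(Shimura), which has infinite order because the row's Heegner point `P` has (both ⟺ `L'(E/K,1) ≠ 0`, Gross–Zagier
= conjunct 1 of `PublishedInputsHeegner`); then S2p on that frame. CONDITIONAL on `hDp`, `hGZ`, `hnf`; nothing
asserted. [cite: Jetchev2008, Conj. 1.3 (p. 812)] [cite: GrossZagier1986, Thm. I.6.3] [cite: GrossLMS1991, §4 (4.1)]
[cite: Darmon2004, Thm. 3.6–3.7] -/
theorem derivedPoint_divisible_at_additive_p_of_conductorLevel_of_grossZagier_of_newforms
    (hDp : ∀ (W : WeierstrassCurve ℚ) [W.IsElliptic] [W.IsGloballyMinimal] [NeZero (W.conductorNorm ℤ)],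
      ¬ W.HasCM →
      ∀ (K : Type) [Field K] [NumberField K], IsImaginaryQuadratic K →
      NumberField.discr K ≠ -3 → NumberField.discr K ≠ -4 →
      SatisfiesHeegnerHypothesis (W.conductorNorm ℤ) K →
      ∀ (p : ℕ) [Fact p.Prime], p ≠ 2 → W.analyticRank = 0 → Addv W p → 0 ≤ padicValRat p W.j →
      W.HasIrreducibleModPGaloisRep p → ¬ (∀ n : ℕ, W.HasSurjectiveModNGaloisRep (p ^ n : ℕ)) →
      (∃ Dt : ModularParametrizationData W (W.conductorNorm ℤ),
        (∀ z ∈ Dt.L.lattice, ∃ w ∈ periodLattice Dt.f, z = (Dt.c : ℂ) * w) ∧ ¬ (p : ℤ) ∣ Dt.c) →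
      ∀ (Dt : ModularParametrizationData W (W.conductorNorm ℤ)) (β : ℤ) (ι : K →+* ℂ)
        (d₁ : KolyvaginHeegnerData Dt β ι 1), ¬ IsOfFinAddOrder d₁.derivedPoint →
      ∀ (s : ℕ), s ≤ padicValNat p ((W.baseChange ℚ_[p]).localTamagawaNumber ℤ_[p]) →
      ∀ (n : ℕ) (d : KolyvaginHeegnerData Dt β ι n), Squarefree n →
        (∀ ℓ ∈ n.primeFactors, Zhang2014.IsKolyvaginPrime (W.conductorNorm ℤ) W K p ℓ ∧
          s ≤ Zhang2014.kolyvaginIndex W p ℓ) →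
        ∃ Q : (W.baseChange (ringClassField K ι n)).toAffine.Point,
          ((p ^ s : ℕ) : ℤ) • Q = d.derivedPoint)
    (hGZ : ∀ (N : ℕ) [NeZero N] (W : WeierstrassCurve ℚ) (K : Type) [Field K] [NumberField K],
      gross_zagier N W K)
    (hnf : exists_isNewformOf)
    (N : ℕ) [NeZero N] (W : WeierstrassCurve ℚ) [W.IsElliptic] [W.IsGloballyMinimal]
    (K : Type) [Field K] [NumberField K] (hK : IsImaginaryQuadratic K)
    (hD3 : NumberField.discr K ≠ -3) (hD4 : NumberField.discr K ≠ -4)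
    (hHN : SatisfiesHeegnerHypothesis N K)
    (p : ℕ) [Fact p.Prime] (hp2 : p ≠ 2) (hr : W.analyticRank = 0) (hadd : Addv W p)
    (hj : 0 ≤ padicValRat p W.j) (hcm : ¬ W.HasCM) (hirr : W.HasIrreducibleModPGaloisRep p)
    (hns : ¬ (∀ n : ℕ, W.HasSurjectiveModNGaloisRep (p ^ n : ℕ)))
    (hopt : ∃ Dt : ModularParametrizationData W N,
      (∀ z ∈ Dt.L.lattice, ∃ w ∈ periodLattice Dt.f, z = (Dt.c : ℂ) * w) ∧ ¬ (p : ℤ) ∣ Dt.c)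
    {P : (W.baseChange K).toAffine.Point} (hP : IsHeegnerPoint N W K P) (hnt : ¬ IsOfFinAddOrder P)
    (Dt : ModularParametrizationData W N) (β : ℤ) (ι : K →+* ℂ) (s : ℕ)
    (hs : s ≤ padicValNat p ((W.baseChange ℚ_[p]).localTamagawaNumber ℤ_[p]))
    (n : ℕ) (d : KolyvaginHeegnerData Dt β ι n) (hn : Squarefree n)
    (hℓ : ∀ ℓ ∈ n.primeFactors, Zhang2014.IsKolyvaginPrime N W K p ℓ ∧ s ≤ Zhang2014.kolyvaginIndex W p ℓ) :
    ∃ Q : (W.baseChange (ringClassField K ι n)).toAffine.Point, ((p ^ s : ℕ) : ℤ) • Q = d.derivedPoint := by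
  -- Carayol from modularity
  obtain ⟨Dt', -, -, -⟩ := id hP
  have hN : N = W.conductorNorm ℤ := IsNewformOf.level_eq_conductorNorm_of_exists_isNewformOf hnf Dt'.isNewformOf
  subst hN
  -- a conductor-1 datum on the GIVEN frame (its orientation congruence is a field of `d`)
  obtain ⟨d₁⟩ := exists_kolyvaginHeegnerData_one (phi_heegnerTau_mem_singularModuliField_holds _ W K) hK Dt β ι
    d.dvd_sq_sub
  -- its derived point descends to a Heegner point `P₀ ∈ E(K)` (Shimura), of infinite order by Gross–Zagier
  obtain ⟨P₀, hheeg, hP₀⟩ := heegnerSystem_exists_isHeegnerPoint_map_eq_derivedPoint_one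
    (heegnerPointOfConductor_one_galoisConj_holds _ W K) hK hHN d₁
  have hL : LDerivEK W K ≠ 0 :=
    (lDerivEK_ne_zero_iff_not_isOfFinAddOrder W (W.conductorNorm ℤ) K (hGZ _ W K) hK hHN hP).mpr hnt
  have hnt₀ : ¬ IsOfFinAddOrder P₀ :=
    (lDerivEK_ne_zero_iff_not_isOfFinAddOrder W (W.conductorNorm ℤ) K (hGZ _ W K) hK hHN hheeg).mp hL
  have hy₁ : ¬ IsOfFinAddOrder d₁.derivedPoint := by
    rw [← hP₀]
    exact fun hfin ↦ hnt₀ ((WeierstrassCurve.Affine.Point.map_injective (W' := W)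
      (f := (algebraMap K (ringClassField K ι 1)).toRatAlgHom)).isOfFinAddOrder_iff.mp hfin)
  exact hDp W hcm K hK hD3 hD4 hHN p hp2 hr hadd hj hirr hns hopt Dt β ι d₁ hy₁ s hs n d hn hℓ

end Summit.BirchSwinnertonDyer.BirchSwinnertonDyer.Theorems.WildJetchevBoundAtPSkeletonRekey

end
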